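import Mathlib

/-!
# The VEGAS map: importance sampling as a separable piecewise-linear change of variables

G. P. Lepage's VEGAS algorithm (J. Comput. Phys. 27 (1978) 192–203, `Lepage1978`; "vegas
enhanced", J. Comput. Phys. 439 (2021) 110386, `Lepage2021`, arXiv:2009.05112) implements
importance sampling for `I = ∫_{[a,b]} f(x) dx` by a change of variables `x = x(y)`, `y ∈ [0,1]ᴰ`,
that is SEPARABLE and PIECEWISE LINEAR in each direction: an axis is divided into `N` increments
`x_0 = a < x_1 < ⋯ < x_N = b`, the point `y = i/N` is sent to the knot `x_i` and `y` varies
linearly in between, so that the Jacobian `J(y) = N Δx_{i(y)}` is a step function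
[Lepage2021, §2.2].  Then `I = ∫_{[0,1]ᴰ} J(y) f(x(y)) dy` [Lepage2021, §2.1 and §2.4], the simple
Monte Carlo estimate `I_MC = (1/M) Σ_y J(y) f(x(y))` over `M` independent uniform points `y` is an
unbiased estimate of `I`, and its variance is `σ_I² = (1/M) (∫_{[0,1]ᴰ} J² f²(x(y)) dy - I²)`
[Lepage2021, §2.1].  (With the grid FROZEN this is the whole error theory of the estimator; the
adaptive part of VEGAS only chooses the grid.)

This file formalises exactly these statements:

* `VegasGrid N` — a grid `x_0 < x_1 < ⋯ < x_N` on one axis; `VegasGrid.map`, `VegasGrid.jac` — the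
  map `x(y) = x_{i(y)} + Δx_{i(y)} (N y - i(y))` and its Jacobian `J(y) = N Δx_{i(y)}`
  [Lepage2021, §2.2]; `VegasGrid.map_mem_Ioo_of_mem_piece`, `VegasGrid.image_map_piece` — the
  `i`-th `y`-increment `(i/N, (i+1)/N)` is mapped onto `(x_i, x_{i+1})`; `VegasGrid.hasDerivAt_map`;
* `VegasGrid.setIntegral_jac_smul_comp_map` — the one-dimensional change of variables
  `∫_{[0,1]} J(y) g(x(y)) dy = ∫_{[a,b]} g(x) dx` for EVERY `g` (no integrability hypothesis: both
  sides are simultaneously meaningful, `VegasGrid.integrableOn_jac_smul_comp_map_iff`)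
  [Lepage2021, §2.1];
* `VegasGrid.mapD`, `VegasGrid.jacD`, `VegasGrid.setIntegral_jacD_smul_comp_mapD` — the
  `D`-dimensional map (an independent grid in each direction), its Jacobian `∏_μ J^μ(y^μ)`, and
  `∫_{[0,1]ᴰ} J(y) g(x(y)) dy = ∫_{[a,b]} g` [Lepage2021, §2.4];
* `VegasGrid.vegasEstimate`, `VegasGrid.integral_vegasEstimate`, `VegasGrid.variance_vegasEstimate`
  — the `M`-sample estimate `I_MC`, its unbiasedness and its variance [Lepage2021, §2.1].

The proofs of the change-of-variables statements use Mathlib's general change of variables formula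
for injective differentiable maps (`MeasureTheory.integral_image_eq_integral_abs_deriv_smul`,
`MeasureTheory.integral_image_eq_integral_abs_det_fderiv_smul`) on the complement of the knots,
a finite union of hyperplanes of measure zero.  Not formalised here: the `x`-space forms
`σ_I² = (1/M)(∫ J(y(x)) f²(x) dx - I²) = (1/M)(Σ_i J_i ∫_{x_i}^{x_{i+1}} f² - I²)` of the variance,
the optimality condition for the grid, and anything adaptive or stratified [Lepage2021, §§2.3, 3].

References: G. P. Lepage, *A new algorithm for adaptive multidimensional integration*, J. Comput.
Phys. 27 (1978) 192–203 (`Lepage1978`); G. P. Lepage, *Adaptive multidimensional integration: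
vegas enhanced*, J. Comput. Phys. 439 (2021) 110386 (`Lepage2021`).

AI-produced formalisation (H21 engines group, seat eng-quad-1, 2026-08-21); no facts, no axioms
beyond Mathlib's, no `sorry`.
-/

open MeasureTheory Set Filter
open scoped Topology ENNReal

noncomputable section

namespace Literature.Analysis.Quadrature

/-- A VEGAS grid with `N` increments on one axis: knots `x_0 < x_1 < ⋯ < x_N` (`x_0 = a`,
`x_N = b`; only the values `x_0, …, x_N` of the sequence matter).
[cite: Lepage2021, §2.2] -/
structure VegasGrid (N : ℕ) where
  /-- the knots `x_i` -/
  x : ℕ → ℝ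
  /-- consecutive knots increase: `Δx_i > 0` for `i < N` -/
  lt_succ : ∀ i < N, x i < x (i + 1)

namespace VegasGrid

variable {N : ℕ} (G : VegasGrid N)

/-! ### The one-dimensional map and its Jacobian -/

/-- The increment widths `Δx_i = x_{i+1} - x_i`. [cite: Lepage2021, §2.2] -/
def width (i : ℕ) : ℝ := G.x (i + 1) - G.x i

/-- `Δx_i > 0`. [folklore] -/
private theorem width_pos {i : ℕ} (hi : i < N) : 0 < G.width i := sub_pos.mpr (G.lt_succ i hi)

/-- The knots increase: `x_i ≤ x_j` for `i ≤ j ≤ N`. [folklore] -/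
private theorem x_mono {i j : ℕ} (hij : i ≤ j) (hj : j ≤ N) : G.x i ≤ G.x j := by
  induction hij with
  | refl => exact le_rfl
  | @step m _ ih =>
    exact (ih (Nat.le_of_succ_le hj)).trans (G.lt_succ m (Nat.lt_of_succ_le hj)).le

/-- `i(y)`: the index of the increment containing `y` — the integer part of `y N`
[cite: Lepage2021, §2.2] (clamped to `N - 1`, which only matters at the endpoint `y = 1` and
outside `[0,1]`). -/
def idx (N : ℕ) (y : ℝ) : ℕ := min ⌊(N : ℝ) * y⌋₊ (N - 1)

/-- The VEGAS map `x(y) = x_{i(y)} + Δx_{i(y)} δ(y)` with `δ(y) = y N - i(y)`: `y = i/N` is sent to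
`x_i` and `x` varies linearly with `y` in between. [cite: Lepage2021, §2.2] -/
def map (y : ℝ) : ℝ := G.x (idx N y) + G.width (idx N y) * ((N : ℝ) * y - idx N y)

/-- The Jacobian `J(y) = N Δx_{i(y)}` of the VEGAS map, a step function.
[cite: Lepage2021, §2.2] -/
def jac (y : ℝ) : ℝ := (N : ℝ) * G.width (idx N y)

/-- The `i`-th `y`-increment `(i/N, (i+1)/N)`, of uniform width `Δy = 1/N`.
[cite: Lepage2021, §2.2] -/
def piece (N i : ℕ) : Set ℝ := Ioo ((i : ℝ) / N) (((i + 1 : ℕ) : ℝ) / N)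

/-- `[0,1]` with the knots `i/N` removed: the union of the open increments. [folklore] -/
def good (N : ℕ) : Set ℝ := ⋃ i : Fin N, piece N i

/-- `i(y) < N`. [folklore] -/
private theorem idx_lt [NeZero N] (y : ℝ) : idx N y < N :=
  (min_le_right _ _).trans_lt (Nat.sub_lt (Nat.pos_of_ne_zero (NeZero.ne N)) one_pos)

/-- The Jacobian is positive. [cite: Lepage2021, §2.2] -/
theorem jac_pos [NeZero N] (y : ℝ) : 0 < G.jac y :=
  mul_pos (Nat.cast_pos.mpr (Nat.pos_of_ne_zero (NeZero.ne N))) (G.width_pos (idx_lt y))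

/-- On the `i`-th increment, `i(y) = i`. [folklore] -/
private theorem idx_eq_of_mem_piece {i : ℕ} (hi : i < N) {y : ℝ} (hy : y ∈ piece N i) :
    idx N y = i := by
  have hN : (0 : ℝ) < N := Nat.cast_pos.mpr (by omega)
  have h1 := hy.1
  have h2 := hy.2
  rw [div_lt_iff₀ hN] at h1
  rw [lt_div_iff₀ hN] at h2
  push_cast at h2
  have hf : ⌊(N : ℝ) * y⌋₊ = i := by
    rw [Nat.floor_eq_iff (by nlinarith [(Nat.cast_nonneg i : (0 : ℝ) ≤ i)])]
    constructor <;> linarith [mul_comm y (N : ℝ)]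
  rw [idx, hf, min_eq_left (by omega)]

/-- On the `i`-th increment the map is affine with slope `N Δx_i`. [folklore] -/
private theorem map_eq_of_mem_piece {i : ℕ} (hi : i < N) {y : ℝ} (hy : y ∈ piece N i) :
    G.map y = (N : ℝ) * G.width i * y + (G.x i - G.width i * i) := by
  rw [map, idx_eq_of_mem_piece hi hy]
  ring

/-- On the `i`-th increment `J(y) = N Δx_i`. [folklore] -/
private theorem jac_eq_of_mem_piece {i : ℕ} (hi : i < N) {y : ℝ} (hy : y ∈ piece N i) :
    G.jac y = (N : ℝ) * G.width i := by
  rw [jac, idx_eq_of_mem_piece hi hy]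

/-- The `i`-th `y`-increment is mapped into the `i`-th `x`-increment `(x_i, x_{i+1})`: increments of
varying widths `Δx_i` in `x`-space correspond to increments of uniform width `1/N` in `y`-space.
[cite: Lepage2021, §2.2] -/
theorem map_mem_Ioo_of_mem_piece {i : ℕ} (hi : i < N) {y : ℝ} (hy : y ∈ piece N i) :
    G.map y ∈ Ioo (G.x i) (G.x (i + 1)) := by
  have hN : (0 : ℝ) < N := Nat.cast_pos.mpr (by omega)
  have hw := G.width_pos hi
  have h1 := hy.1
  have h2 := hy.2
  rw [div_lt_iff₀ hN] at h1
  rw [lt_div_iff₀ hN] at h2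
  push_cast at h2
  rw [map, idx_eq_of_mem_piece hi hy]
  have ht0 : 0 < (N : ℝ) * y - i := by linarith [mul_comm y (N : ℝ)]
  have ht1 : (N : ℝ) * y - i < 1 := by linarith [mul_comm y (N : ℝ)]
  refine ⟨lt_add_of_pos_right _ (mul_pos hw ht0), ?_⟩
  have := mul_lt_of_lt_one_right hw ht1
  simp only [width] at this ⊢
  linarith

/-- The `i`-th `y`-increment is mapped ONTO the `i`-th `x`-increment `(x_i, x_{i+1})`.
[cite: Lepage2021, §2.2] -/
theorem image_map_piece {i : ℕ} (hi : i < N) : G.map '' piece N i = Ioo (G.x i) (G.x (i + 1)) := by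
  have hN : (0 : ℝ) < N := Nat.cast_pos.mpr (by omega)
  have hN' : (N : ℝ) ≠ 0 := hN.ne'
  have he : EqOn G.map (fun y => (N : ℝ) * G.width i * y + (G.x i - G.width i * i)) (piece N i) :=
    fun y hy => G.map_eq_of_mem_piece hi hy
  rw [he.image_eq, piece, Set.image_affine_Ioo (mul_pos hN (G.width_pos hi))]
  congr 1
  · field_simp
    ring
  · simp only [width]
    push_cast
    field_simp
    ring

/-- **The Jacobian of the VEGAS map** [cite: Lepage2021, §2.2]: off the knots `i/N` the map is
differentiable with derivative `J(y) = N Δx_{i(y)}`. -/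
theorem hasDerivAt_map {i : ℕ} (hi : i < N) {y : ℝ} (hy : y ∈ piece N i) :
    HasDerivAt G.map (G.jac y) y := by
  have haff : HasDerivAt (fun y : ℝ => (N : ℝ) * G.width i * y + (G.x i - G.width i * i))
      ((N : ℝ) * G.width i) y := by
    simpa using ((hasDerivAt_id y).const_mul ((N : ℝ) * G.width i)).add_const
      (G.x i - G.width i * i)
  rw [G.jac_eq_of_mem_piece hi hy]
  refine haff.congr_of_eventuallyEq ?_
  filter_upwards [isOpen_Ioo.mem_nhds hy] with y' hy'
  exact G.map_eq_of_mem_piece hi hy'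

/-- The union of the open increments is measurable. [folklore] -/
private theorem measurableSet_good : MeasurableSet (good N) :=
  MeasurableSet.iUnion fun _ => measurableSet_Ioo

/-- Off the knots, the map is differentiable with derivative `J(y)`. [folklore] -/
private theorem hasDerivWithinAt_map {y : ℝ} (hy : y ∈ good N) :
    HasDerivWithinAt G.map (G.jac y) (good N) y := by
  obtain ⟨i, hi⟩ := mem_iUnion.1 hy
  exact (G.hasDerivAt_map i.isLt hi).hasDerivWithinAt

/-- The VEGAS map is injective off the knots. [folklore] -/
private theorem injOn_map : InjOn G.map (good N) := by
  intro y hy y' hy' h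
  obtain ⟨i, hi⟩ := mem_iUnion.1 hy
  obtain ⟨i', hi'⟩ := mem_iUnion.1 hy'
  have hm := G.map_mem_Ioo_of_mem_piece i.isLt hi
  have hm' := G.map_mem_Ioo_of_mem_piece i'.isLt hi'
  have hiN := i.isLt
  have hi'N := i'.isLt
  rcases lt_trichotomy (i : ℕ) i' with hlt | heq | hgt
  · exfalso
    have : G.x (i + 1) ≤ G.x i' := G.x_mono (by omega) (by omega)
    linarith [hm.2, hm'.1]
  · rw [← heq] at hi'
    have hN : (0 : ℝ) < N := Nat.cast_pos.mpr (by omega)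
    rw [G.map_eq_of_mem_piece i.isLt hi, G.map_eq_of_mem_piece i.isLt hi'] at h
    exact mul_left_cancel₀ (mul_pos hN (G.width_pos i.isLt)).ne' (add_right_cancel h)
  · exfalso
    have : G.x (i' + 1) ≤ G.x i := G.x_mono (by omega) (by omega)
    linarith [hm'.2, hm.1]

/-- The image of `[0,1]` minus the knots is `[a,b]` minus the knots. [folklore] -/
private theorem image_map_good : G.map '' good N = ⋃ i : Fin N, Ioo (G.x i) (G.x (i + 1)) := by
  rw [good, image_iUnion]
  exact iUnion_congr fun i => G.image_map_piece i.isLt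

/-- For a monotone finite sequence of knots, `[g_0, g_N]` minus the open increments consists of
knots only. [folklore] -/
private theorem Icc_diff_iUnion_Ioo_subset {g : ℕ → ℝ} {N : ℕ} :
    Icc (g 0) (g N) \ (⋃ i : Fin N, Ioo (g i) (g (i + 1))) ⊆ g '' {i | i ≤ N} := by
  rintro z ⟨⟨h0, hN⟩, hz⟩
  by_contra hne
  have hne' : ∀ i ≤ N, z ≠ g i := fun i hi e => hne ⟨i, hi, e.symm⟩
  have key : ∀ i ≤ N, g i < z := by
    intro i
    induction i with
    | zero => exact fun h => lt_of_le_of_ne h0 (hne' 0 h).symm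
    | succ i ih =>
      intro h
      have hlt := ih (Nat.le_of_succ_le h)
      have hnot : ¬ z < g (i + 1) := fun hz' => hz (mem_iUnion.2 ⟨⟨i, h⟩, hlt, hz'⟩)
      exact lt_of_le_of_ne (not_lt.1 hnot) (hne' (i + 1) h).symm
  exact absurd hN (not_le.2 (key N le_rfl))

/-- For a monotone finite sequence of knots, the union of the open increments is `[g_0, g_N]` up to
a Lebesgue-null set. [folklore] -/
private theorem iUnion_Ioo_ae_eq_Icc {g : ℕ → ℝ} {N : ℕ}
    (hg : ∀ ⦃i j : ℕ⦄, i ≤ j → j ≤ N → g i ≤ g j) :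
    (⋃ i : Fin N, Ioo (g i) (g (i + 1))) =ᵐ[volume] Icc (g 0) (g N) := by
  refine ae_eq_set.2 ⟨?_, ?_⟩
  · rw [Set.sdiff_eq_empty.2 (iUnion_subset fun i => ?_), measure_empty]
    exact fun z hz => ⟨(hg (Nat.zero_le i) i.isLt.le).trans hz.1.le,
      hz.2.le.trans (hg (Nat.succ_le_of_lt i.isLt) le_rfl)⟩
  · exact measure_mono_null Icc_diff_iUnion_Ioo_subset
      (((Set.finite_le_nat N).image g).measure_zero volume)

/-- `[0,1]` minus the knots is `[0,1]` up to a null set. [folklore] -/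
private theorem good_ae_eq_Icc [NeZero N] : good N =ᵐ[volume] Icc (0 : ℝ) 1 := by
  have hN' : (N : ℝ) ≠ 0 := Nat.cast_ne_zero.mpr (NeZero.ne N)
  have h := iUnion_Ioo_ae_eq_Icc (g := fun i : ℕ => (i : ℝ) / N) (N := N)
    (fun i j hij _ => div_le_div_of_nonneg_right (Nat.cast_le.mpr hij) (Nat.cast_nonneg N))
  have e : Icc ((fun i : ℕ => (i : ℝ) / N) 0) ((fun i : ℕ => (i : ℝ) / N) N) = Icc (0 : ℝ) 1 := by
    simp [hN']
  rw [e] at h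
  exact h

/-! ### The one-dimensional change of variables -/

variable {F : Type*} [NormedAddCommGroup F] [NormedSpace ℝ F]

/-- **Change of variables by the VEGAS map** [cite: Lepage2021, §2.1] (with the map and Jacobian of
[Lepage2021, §2.2]): `∫_{[0,1]} J(y) g(x(y)) dy = ∫_{[a,b]} g(x) dx` for every `g` (both sides are
junk together when `g` is not integrable, cf. `integrableOn_jac_smul_comp_map_iff`). -/
theorem setIntegral_jac_smul_comp_map [NeZero N] (g : ℝ → F) :
    ∫ y in Icc (0 : ℝ) 1, G.jac y • g (G.map y) = ∫ x in Icc (G.x 0) (G.x N), g x := by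
  calc ∫ y in Icc (0 : ℝ) 1, G.jac y • g (G.map y)
      = ∫ y in good N, G.jac y • g (G.map y) :=
        (setIntegral_congr_set (good_ae_eq_Icc (N := N))).symm
    _ = ∫ y in good N, |G.jac y| • g (G.map y) :=
        setIntegral_congr_fun measurableSet_good fun y _ => by rw [abs_of_pos (G.jac_pos y)]
    _ = ∫ x in G.map '' good N, g x :=
        (integral_image_eq_integral_abs_deriv_smul measurableSet_good
          (fun y hy => G.hasDerivWithinAt_map hy) G.injOn_map g).symm
    _ = ∫ x in Icc (G.x 0) (G.x N), g x := by
        rw [G.image_map_good]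
        exact setIntegral_congr_set (iUnion_Ioo_ae_eq_Icc fun i j hij hj => G.x_mono hij hj)

/-- `J(y) g(x(y))` is integrable on `[0,1]` iff `g` is integrable on `[a,b]`.
[cite: Lepage2021, §2.1] -/
theorem integrableOn_jac_smul_comp_map_iff [NeZero N] (g : ℝ → F) :
    IntegrableOn (fun y => G.jac y • g (G.map y)) (Icc 0 1) ↔
      IntegrableOn g (Icc (G.x 0) (G.x N)) := by
  rw [← integrableOn_congr_set_ae (good_ae_eq_Icc (N := N)),
    ← integrableOn_congr_set_ae (iUnion_Ioo_ae_eq_Icc fun i j hij hj => G.x_mono hij hj),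
    ← G.image_map_good, integrableOn_image_iff_integrableOn_abs_deriv_smul measurableSet_good
      (fun y hy => G.hasDerivWithinAt_map hy) G.injOn_map]
  exact integrableOn_congr_fun (fun y _ => by rw [abs_of_pos (G.jac_pos y)]) measurableSet_good

/-- The change of variables in interval-integral form: `∫₀¹ J(y) g(x(y)) dy = ∫ₐᵇ g(x) dx`.
[cite: Lepage2021, §2.1] -/
theorem intervalIntegral_jac_smul_comp_map [NeZero N] (g : ℝ → F) :
    ∫ y in (0 : ℝ)..1, G.jac y • g (G.map y) = ∫ x in (G.x 0)..(G.x N), g x := by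
  rw [intervalIntegral.integral_of_le zero_le_one,
    intervalIntegral.integral_of_le (G.x_mono (Nat.zero_le N) le_rfl),
    ← integral_Icc_eq_integral_Ioc, ← integral_Icc_eq_integral_Ioc]
  exact G.setIntegral_jac_smul_comp_map g

/-! ### The `D`-dimensional map -/

variable {ι : Type*} [Fintype ι]

/-- The `D`-dimensional VEGAS map: an independent grid `G μ` in each direction `μ`,
`x(y)^μ = x^μ(y^μ)`. [cite: Lepage2021, §2.4] -/
def mapD (G : ι → VegasGrid N) (y : ι → ℝ) : ι → ℝ := fun μ => (G μ).map (y μ)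

/-- Its Jacobian `J(y) = ∏_μ J^μ(y^μ)`. [cite: Lepage2021, §2.4] -/
def jacD (G : ι → VegasGrid N) (y : ι → ℝ) : ℝ := ∏ μ, (G μ).jac (y μ)

/-- The `D`-dimensional Jacobian is positive. [cite: Lepage2021, §2.4] -/
theorem jacD_pos [NeZero N] (G : ι → VegasGrid N) (y : ι → ℝ) : 0 < jacD G y :=
  Finset.prod_pos fun μ _ => (G μ).jac_pos (y μ)

/-- The unit cube with the knot hyperplanes removed. [folklore] -/
def goodD (ι : Type*) (N : ℕ) : Set (ι → ℝ) := Set.pi univ fun _ => good N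

/-- The cube minus the knot hyperplanes is measurable. [folklore] -/
private theorem measurableSet_goodD : MeasurableSet (goodD ι N) :=
  MeasurableSet.univ_pi fun _ => measurableSet_good

/-- The derivative of the `D`-dimensional map off the knot hyperplanes: the diagonal linear map
with entries `J^μ(y^μ)`. [folklore] -/
private def fderivMapD (G : ι → VegasGrid N) (y : ι → ℝ) : (ι → ℝ) →L[ℝ] (ι → ℝ) :=
  ContinuousLinearMap.pi fun μ =>
    (ContinuousLinearMap.smulRight (1 : ℝ →L[ℝ] ℝ) ((G μ).jac (y μ))).comp
      (ContinuousLinearMap.proj μ)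

/-- Off the knot hyperplanes, the `D`-dimensional map is differentiable with the diagonal
derivative `fderivMapD`. [folklore] -/
private theorem hasFDerivWithinAt_mapD (G : ι → VegasGrid N) {y : ι → ℝ} (hy : y ∈ goodD ι N) :
    HasFDerivWithinAt (mapD G) (fderivMapD G y) (goodD ι N) y := by
  refine (hasFDerivAt_pi.2 fun μ => ?_).hasFDerivWithinAt
  have h1 : HasDerivAt (G μ).map ((G μ).jac (y μ)) (y μ) := by
    obtain ⟨i, hi⟩ := mem_iUnion.1 (hy μ (mem_univ μ))
    exact (G μ).hasDerivAt_map i.isLt hi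
  exact h1.hasFDerivAt.comp y (hasFDerivAt_apply μ y)

/-- Its determinant is the Jacobian `∏_μ J^μ(y^μ)`. [folklore] -/
private theorem det_fderivMapD (G : ι → VegasGrid N) (y : ι → ℝ) :
    (fderivMapD G y).det = jacD G y := by
  rw [fderivMapD, ContinuousLinearMap.det_pi]
  simp [jacD]

omit [Fintype ι] in
/-- The `D`-dimensional map is injective off the knot hyperplanes. [folklore] -/
private theorem injOn_mapD (G : ι → VegasGrid N) : InjOn (mapD G) (goodD ι N) :=
  fun _ hy _ hy' h =>
    funext fun μ => (G μ).injOn_map (hy μ (mem_univ μ)) (hy' μ (mem_univ μ)) (congr_fun h μ)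

/-- The cube minus the knot hyperplanes is the cube up to a null set. [folklore] -/
private theorem goodD_ae_eq_Icc [NeZero N] : goodD ι N =ᵐ[volume] Icc (0 : ι → ℝ) 1 := by
  rw [volume_pi, ← Set.pi_univ_Icc (0 : ι → ℝ) 1]
  exact Measure.ae_eq_set_pi fun μ _ => good_ae_eq_Icc (N := N)

/-- The image of the cube minus the knot hyperplanes is the box, up to a null set. [folklore] -/
private theorem image_mapD_ae_eq_Icc (G : ι → VegasGrid N) :
    mapD G '' goodD ι N =ᵐ[volume] Icc (fun μ => (G μ).x 0) (fun μ => (G μ).x N) := by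
  have himage : mapD G '' goodD ι N = Set.pi univ fun μ => (G μ).map '' good N :=
    Set.piMap_image_univ_pi (fun μ => (G μ).map) fun _ => good N
  rw [himage, volume_pi, ← Set.pi_univ_Icc]
  refine Measure.ae_eq_set_pi fun μ _ => ?_
  rw [(G μ).image_map_good]
  exact iUnion_Ioo_ae_eq_Icc fun i j hij hj => (G μ).x_mono hij hj

/-- **Change of variables by the `D`-dimensional VEGAS map** [cite: Lepage2021, §2.4]:
`∫_{[0,1]ᴰ} J(y) g(x(y)) dy = ∫_{∏[a^μ,b^μ]} g(x) dx` for every `g`. -/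
theorem setIntegral_jacD_smul_comp_mapD [NeZero N] (G : ι → VegasGrid N) (g : (ι → ℝ) → F) :
    ∫ y in Icc (0 : ι → ℝ) 1, jacD G y • g (mapD G y) =
      ∫ x in Icc (fun μ => (G μ).x 0) (fun μ => (G μ).x N), g x := by
  calc ∫ y in Icc (0 : ι → ℝ) 1, jacD G y • g (mapD G y)
      = ∫ y in goodD ι N, jacD G y • g (mapD G y) :=
        (setIntegral_congr_set (goodD_ae_eq_Icc (N := N))).symm
    _ = ∫ y in goodD ι N, |(fderivMapD G y).det| • g (mapD G y) :=
        setIntegral_congr_fun measurableSet_goodD fun y _ => by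
          rw [det_fderivMapD, abs_of_pos (jacD_pos G y)]
    _ = ∫ x in mapD G '' goodD ι N, g x :=
        (integral_image_eq_integral_abs_det_fderiv_smul volume measurableSet_goodD
          (fun y hy => hasFDerivWithinAt_mapD G hy) (injOn_mapD G) g).symm
    _ = ∫ x in Icc (fun μ => (G μ).x 0) (fun μ => (G μ).x N), g x :=
        setIntegral_congr_set (image_mapD_ae_eq_Icc G)

/-- `J(y) g(x(y))` is integrable on `[0,1]ᴰ` iff `g` is integrable on the box.
[cite: Lepage2021, §2.4] -/
theorem integrableOn_jacD_smul_comp_mapD_iff [NeZero N] (G : ι → VegasGrid N) (g : (ι → ℝ) → F) :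
    IntegrableOn (fun y => jacD G y • g (mapD G y)) (Icc (0 : ι → ℝ) 1) ↔
      IntegrableOn g (Icc (fun μ => (G μ).x 0) (fun μ => (G μ).x N)) := by
  rw [← integrableOn_congr_set_ae (goodD_ae_eq_Icc (N := N)),
    ← integrableOn_congr_set_ae (image_mapD_ae_eq_Icc G),
    integrableOn_image_iff_integrableOn_abs_det_fderiv_smul volume measurableSet_goodD
      (fun y hy => hasFDerivWithinAt_mapD G hy) (injOn_mapD G)]
  exact integrableOn_congr_fun (fun y _ => by rw [det_fderivMapD, abs_of_pos (jacD_pos G y)])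
    measurableSet_goodD

/-! ### The Monte Carlo estimate: unbiasedness and variance -/

/-- The uniform probability measure on the unit cube `[0,1]ᴰ` (the law of one sample point `y`).
[cite: Lepage2021, §2.4] -/
def unifCube (ι : Type*) [Fintype ι] : Measure (ι → ℝ) :=
  (volume : Measure (ι → ℝ)).restrict (Icc 0 1)

/-- The unit cube has volume one. [folklore] -/
instance isProbabilityMeasure_unifCube : IsProbabilityMeasure (unifCube ι) :=
  ⟨by rw [unifCube, Measure.restrict_apply_univ, Real.volume_Icc_pi]; simp⟩

/-- The simple Monte Carlo estimate of `I` in `y`-space from `M` sample points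
`y_1, …, y_M ∈ [0,1]ᴰ`: `I_MC = (1/M) Σ_m J(y_m) g(x(y_m))`. [cite: Lepage2021, §2.1] -/
def vegasEstimate (G : ι → VegasGrid N) (g : (ι → ℝ) → F) (M : ℕ) (ys : Fin M → (ι → ℝ)) : F :=
  (M : ℝ)⁻¹ • ∑ m, jacD G (ys m) • g (mapD G (ys m))

/-- The expectation of `h(y_m)` over `M` independent uniform points is the integral of `h` over the
cube. [folklore] -/
private theorem integral_comp_eval {M : ℕ} {E : Type*} [NormedAddCommGroup E] [NormedSpace ℝ E]
    {h : (ι → ℝ) → E} (hh : Integrable h (unifCube ι)) (m : Fin M) :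
    ∫ ys, h (ys m) ∂(Measure.pi fun _ : Fin M => unifCube ι) = ∫ y, h y ∂(unifCube ι) := by
  have H := measurePreserving_eval (fun _ : Fin M => unifCube ι) m
  have key := integral_map (μ := Measure.pi fun _ : Fin M => unifCube ι) H.measurable.aemeasurable
    (f := h) (by rw [H.map_eq]; exact hh.aestronglyMeasurable)
  rw [H.map_eq] at key
  exact key.symm

/-- **The VEGAS estimate is unbiased** [cite: Lepage2021, §2.1] ("`I_MC` is itself a random number
whose mean is the exact value `I` of the integral"), for `M ≥ 1` independent uniform sample points
and `g` integrable on the box. -/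
theorem integral_vegasEstimate [NeZero N] (G : ι → VegasGrid N) {M : ℕ} [NeZero M]
    {g : (ι → ℝ) → F} (hg : IntegrableOn g (Icc (fun μ => (G μ).x 0) (fun μ => (G μ).x N))) :
    ∫ ys, vegasEstimate G g M ys ∂(Measure.pi fun _ : Fin M => unifCube ι) =
      ∫ x in Icc (fun μ => (G μ).x 0) (fun μ => (G μ).x N), g x := by
  have hInt : Integrable (fun y => jacD G y • g (mapD G y)) (unifCube ι) :=
    (integrableOn_jacD_smul_comp_mapD_iff G g).2 hg
  have hm : ∀ m : Fin M, Integrable (fun ys : Fin M → ι → ℝ => jacD G (ys m) • g (mapD G (ys m)))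
      (Measure.pi fun _ : Fin M => unifCube ι) := fun m =>
    ((measurePreserving_eval (fun _ : Fin M => unifCube ι) m).integrable_comp
      hInt.aestronglyMeasurable).mpr hInt
  simp only [vegasEstimate]
  rw [integral_smul, integral_finsetSum _ fun m _ => hm m]
  simp_rw [integral_comp_eval hInt]
  rw [Finset.sum_const, Finset.card_univ, Fintype.card_fin, ← Nat.cast_smul_eq_nsmul ℝ,
    inv_smul_smul₀ (Nat.cast_ne_zero.mpr (NeZero.ne M))]
  exact setIntegral_jacD_smul_comp_mapD G g

open ProbabilityTheory in
/-- **Variance of the VEGAS estimate** [cite: Lepage2021, §2.1]: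
`σ_I² = (1/M) (∫_{[0,1]ᴰ} J²(y) f²(x(y)) dy - I²)` for real `f` with `J f(x(·))` square integrable
("sufficiently integrable") and `M ≥ 1` independent uniform sample points. -/
theorem variance_vegasEstimate [NeZero N] (G : ι → VegasGrid N) {M : ℕ} [NeZero M]
    {f : (ι → ℝ) → ℝ} (hf : MemLp (fun y => jacD G y * f (mapD G y)) 2 (unifCube ι)) :
    variance (vegasEstimate G f M) (Measure.pi fun _ : Fin M => unifCube ι) =
      (M : ℝ)⁻¹ * ((∫ y in Icc (0 : ι → ℝ) 1, (jacD G y * f (mapD G y)) ^ 2) -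
        (∫ x in Icc (fun μ => (G μ).x 0) (fun μ => (G μ).x N), f x) ^ 2) := by
  set P : Measure (Fin M → ι → ℝ) := Measure.pi fun _ : Fin M => unifCube ι with hP
  set h : (ι → ℝ) → ℝ := fun y => jacD G y * f (mapD G y) with hh
  have Hm : ∀ m : Fin M, MeasurePreserving (Function.eval m) P (unifCube ι) := fun m =>
    measurePreserving_eval _ m
  have hX : ∀ m : Fin M, MemLp (fun ys : Fin M → ι → ℝ => h (ys m)) 2 P := fun m =>
    hf.comp_measurePreserving (Hm m)
  have hind : iIndepFun (fun (m : Fin M) (ys : Fin M → ι → ℝ) => h (ys m)) P :=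
    iIndepFun_pi (X := fun _ : Fin M => h) fun _ => hf.aestronglyMeasurable.aemeasurable
  have e : vegasEstimate G f M = fun ys => (M : ℝ)⁻¹ * (∑ m : Fin M, fun ys => h (ys m)) ys := by
    funext ys
    simp [vegasEstimate, hh, Finset.sum_apply, smul_eq_mul]
  rw [e, variance_const_mul, IndepFun.variance_sum (fun m _ => hX m)
    (fun i _ j _ hij => hind.indepFun hij)]
  have hv : ∀ m : Fin M,
      variance (fun ys : Fin M → ι → ℝ => h (ys m)) P = variance h (unifCube ι) := fun m =>
    (Hm m).variance_fun_comp hf.aestronglyMeasurable.aemeasurable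
  simp_rw [hv]
  rw [Finset.sum_const, Finset.card_univ, Fintype.card_fin, nsmul_eq_mul, variance_eq_sub hf]
  have hI : ∫ y, h y ∂(unifCube ι) = ∫ x in Icc (fun μ => (G μ).x 0) (fun μ => (G μ).x N), f x := by
    rw [hh, unifCube, ← setIntegral_jacD_smul_comp_mapD G f]
    simp only [smul_eq_mul]
  have hI2 : ∫ y, (h ^ 2) y ∂(unifCube ι) =
      ∫ y in Icc (0 : ι → ℝ) 1, (jacD G y * f (mapD G y)) ^ 2 := by
    simp only [hh, unifCube, Pi.pow_apply]
  rw [hI, hI2]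
  have hM : (M : ℝ) ≠ 0 := Nat.cast_ne_zero.mpr (NeZero.ne M)
  field_simp

end VegasGrid

end Literature.Analysis.Quadrature

end
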